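import Mathlib
import Summits.NavierStokesRegularity.NavierStokesRegularity.Theorems.EulerZoomLiouvillePowerGaugeEulerLiouvilleLionsGate
import HarnessLib

/-!
# Tools for the extinct-trace stratum X2 («no conservative Euler collapse into rest»)
# (crux `EulerZoomLiouville.PowerGaugeEulerLiouville` = stmt-NavierStokesRegularity-19832; line `extinct-trace` of ns-idea-11, stub X2
# `stub_extinctIdentity`; width seat ns-ezl-w1 g4)

Measure-theoretic plumbing for `…ExtinctIdentity.lean`:
* `setLIntegral_ball_enorm_sq_lt_top_of_gaugeA` — the `A`-gauge is a SUPREMUM over the slices, so EVERY slice `u(s)`, `−a² < s < 0`,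
  is square-integrable on `B_a`;
* `ae_aestronglyMeasurable_slice` — a.e. slice of a member is a.e.-strongly measurable;
* `abs_integral_integral_flux_le` — the cutoff flux `|∫_{(s,σ)} ∫ (|u|² + 2p)⟪u, ∇χ⟫|` is bounded by `‖∇χ‖_∞` times the
  lower-Lebesgue flux mass `∫∫_{(s,0) × B} (|u|³ + 2|p||u|)` of any ball `B` carrying `∇χ` (no integrability needed:
  `‖∫f‖ₑ ≤ ∫⁻‖f‖ₑ` twice and Tonelli);
* `integral_mul_sq_le_of_setLIntegral_le`, `setLIntegral_ball_le_ofReal_integral` — the cutoff energy `∫ χ|v|²` against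
  `∫⁻_{B}‖v‖ₑ²` in both directions.

WHAT THIS IS NOT: not NS, not E — `--supports` stmt-19832; 19832 OPEN; NS regularity NOT proved. [folklore]
-/

noncomputable section

-- flat `Theorems/<Route><Decl>…` files of one crux share the namespace of the crux (tree convention)
set_option linter.dupNamespace false

open MeasureTheory Set Filter Topology Metric Function InnerProductSpace TopologicalSpace
open scoped RealInnerProductSpace NNReal ENNReal

namespace Summit.NavierStokesRegularity.NavierStokesRegularity.Theorems.PowerGaugeEulerLiouville.ExtinctTrace

open Literature.Analysis Literature.Analysis.FluidPDE

/-- **Every slice of a member is locally `L²`** (the `A`-gauge is a supremum, not an essential supremum): if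
`a^{2ρ} A(a) ≤ c` then `∫_{B_a} |u(s)|² < ∞` for every `−a² < s < 0`. [folklore] -/
theorem setLIntegral_ball_enorm_sq_lt_top_of_gaugeA {ρ : ℝ}
    {u : ℝ → EuclideanSpace ℝ (Fin 3) → EuclideanSpace ℝ (Fin 3)} {c : ℝ≥0}
    (hA : ∀ a : ℝ, 0 < a → ENNReal.ofReal (a ^ (2 * ρ)) * cknA a (0 : ℝ × EuclideanSpace ℝ (Fin 3)) u ≤ (c : ℝ≥0∞))
    {a s : ℝ} (ha : 0 < a) (hs : s ∈ Ioo (-(a ^ 2)) 0) :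
    ∫⁻ x in ball (0 : EuclideanSpace ℝ (Fin 3)) a, ‖u s x‖ₑ ^ 2 < ⊤ := by
  have hfin : cknA a (0 : ℝ × EuclideanSpace ℝ (Fin 3)) u < ⊤ :=
    LionsGate.lt_top_of_mul_le (ENNReal.ofReal_pos.2 (Real.rpow_pos_of_pos ha _)).ne' (hA a ha)
  have hle : (ENNReal.ofReal a)⁻¹ * ∫⁻ x in ball (0 : EuclideanSpace ℝ (Fin 3)) a, ‖u s x‖ₑ ^ 2 ≤
      cknA a (0 : ℝ × EuclideanSpace ℝ (Fin 3)) u := by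
    unfold cknA
    have hs' : s ∈ Ioo ((0 : ℝ) - a ^ 2) 0 := by simpa using hs
    exact le_iSup₂ (f := fun t _ => (ENNReal.ofReal a)⁻¹ *
      ∫⁻ x in ball (0 : EuclideanSpace ℝ (Fin 3)) a, ‖u t x‖ₑ ^ 2) s hs'
  exact lt_of_le_of_lt (LionsGate.le_mul_inv_mul (ENNReal.ofReal_pos.2 ha).ne' ENNReal.ofReal_ne_top)
    (ENNReal.mul_lt_top ENNReal.ofReal_lt_top (lt_of_le_of_lt hle hfin))

/-- **A.e. slice of a member is a.e.-strongly measurable** (from the a.e.-strong measurability of `uncurry u` on the slab,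
through the zero extension and `Measure.ae_ae_eq_curry_of_prod`). [folklore] -/
theorem ae_aestronglyMeasurable_slice {F : Type*} [NormedAddCommGroup F]
    {u : ℝ → EuclideanSpace ℝ (Fin 3) → F}
    (hum : AEStronglyMeasurable (uncurry u)
      (volume.restrict (Iio (0 : ℝ) ×ˢ (univ : Set (EuclideanSpace ℝ (Fin 3)))))) :
    ∀ᵐ s ∂(volume : Measure ℝ), s < 0 → AEStronglyMeasurable (u s) volume := by
  set S : Set (ℝ × EuclideanSpace ℝ (Fin 3)) := Iio (0 : ℝ) ×ˢ (univ : Set (EuclideanSpace ℝ (Fin 3))) with hS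
  have hSm : MeasurableSet S := measurableSet_Iio.prod MeasurableSet.univ
  set w : ℝ × EuclideanSpace ℝ (Fin 3) → F := S.indicator (uncurry u) with hw
  have h1 : AEStronglyMeasurable w volume := (aestronglyMeasurable_indicator_iff hSm).2 hum
  have h2 : ∀ᵐ t ∂(volume : Measure ℝ), AEStronglyMeasurable (fun y => h1.mk w (t, y)) volume :=
    Eventually.of_forall fun t =>
      (h1.stronglyMeasurable_mk.comp_measurable measurable_prodMk_left).aestronglyMeasurable
  have h3 : ∀ᵐ t ∂(volume : Measure ℝ), (fun y => h1.mk w (t, y)) =ᵐ[volume] fun y => w (t, y) := by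
    have h : w =ᵐ[(volume : Measure ℝ).prod (volume : Measure (EuclideanSpace ℝ (Fin 3)))] h1.mk w :=
      h1.ae_eq_mk
    exact (Measure.ae_ae_eq_curry_of_prod h).mono fun t ht => ht.symm
  filter_upwards [h2, h3] with t h2 h3 ht
  refine (h2.congr h3).congr (Eventually.of_forall fun y => ?_)
  have : ((t, y) : ℝ × EuclideanSpace ℝ (Fin 3)) ∈ S := ⟨ht, mem_univ _⟩
  simp only [hw, indicator_of_mem this, uncurry_apply_pair]

/-- **The cutoff flux is controlled by the flux mass** (no integrability hypotheses): if `‖∇χ‖ ≤ D` everywhere, `∇χ = 0` off a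
ball `B`, and `∫∫_{(s,0) × B} (|u|³ + 2|p||u|) ≤ M` (lower Lebesgue integral), then for every `s < σ ≤ 0`
`|∫_{τ ∈ (s,σ)} ∫ (|u|² + 2p)⟪u, ∇χ⟫| ≤ D M` (`‖∫f‖ₑ ≤ ∫⁻‖f‖ₑ` twice, monotonicity, Tonelli). [folklore] -/
theorem abs_integral_integral_flux_le
    {u : ℝ → EuclideanSpace ℝ (Fin 3) → EuclideanSpace ℝ (Fin 3)} {p : ℝ → EuclideanSpace ℝ (Fin 3) → ℝ}
    {s : ℝ} {x₁ : EuclideanSpace ℝ (Fin 3)} {b : ℝ}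
    (hum : AEStronglyMeasurable (uncurry u) (volume.restrict (Ioo s 0 ×ˢ ball x₁ b)))
    (hpm : AEStronglyMeasurable (uncurry p) (volume.restrict (Ioo s 0 ×ˢ ball x₁ b)))
    {χ : EuclideanSpace ℝ (Fin 3) → ℝ} {D : ℝ} (hD0 : 0 ≤ D) (hD : ∀ x, ‖gradient χ x‖ ≤ D)
    (hχ0 : ∀ x, x ∉ ball x₁ b → gradient χ x = 0) {M : ℝ} (hM : 0 ≤ M)
    (hflux : ∫⁻ z in Ioo s 0 ×ˢ ball x₁ b,
      (‖u z.1 z.2‖ₑ ^ (3 : ℕ) + 2 * (‖p z.1 z.2‖ₑ * ‖u z.1 z.2‖ₑ)) ≤ ENNReal.ofReal M)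
    {σ : ℝ} (hσ : σ ≤ 0) :
    |∫ τ in Ioo s σ, ∫ x, (‖u τ x‖ ^ 2 + 2 * p τ x) * ⟪u τ x, gradient χ x⟫| ≤ D * M := by
  set R : ℝ → EuclideanSpace ℝ (Fin 3) → ℝ := fun τ x => (‖u τ x‖ ^ 2 + 2 * p τ x) * ⟪u τ x, gradient χ x⟫ with hR
  set g : ℝ → EuclideanSpace ℝ (Fin 3) → ℝ≥0∞ := fun τ x =>
    ‖u τ x‖ₑ ^ (3 : ℕ) + 2 * (‖p τ x‖ₑ * ‖u τ x‖ₑ) with hg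
  -- pointwise domination
  have hpt : ∀ τ x, ‖R τ x‖ₑ ≤ ENNReal.ofReal D * (ball x₁ b).indicator (g τ) x := by
    intro τ x
    by_cases hx : x ∈ ball x₁ b
    · rw [indicator_of_mem hx]
      have h1 : ‖R τ x‖ ≤ D * (‖u τ x‖ ^ 3 + 2 * (|p τ x| * ‖u τ x‖)) := by
        have hin : |⟪u τ x, gradient χ x⟫| ≤ ‖u τ x‖ * D :=
          (abs_real_inner_le_norm _ _).trans (mul_le_mul_of_nonneg_left (hD x) (norm_nonneg _))
        have hco : |‖u τ x‖ ^ 2 + 2 * p τ x| ≤ ‖u τ x‖ ^ 2 + 2 * |p τ x| := by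
          refine (abs_add_le _ _).trans ?_
          rw [abs_of_nonneg (sq_nonneg _), abs_mul, abs_two]
        rw [hR, Real.norm_eq_abs, abs_mul]
        calc |‖u τ x‖ ^ 2 + 2 * p τ x| * |⟪u τ x, gradient χ x⟫|
            ≤ (‖u τ x‖ ^ 2 + 2 * |p τ x|) * (‖u τ x‖ * D) :=
              mul_le_mul hco hin (abs_nonneg _) (by positivity)
          _ = D * (‖u τ x‖ ^ 3 + 2 * (|p τ x| * ‖u τ x‖)) := by ring
      have h2 : ENNReal.ofReal (D * (‖u τ x‖ ^ 3 + 2 * (|p τ x| * ‖u τ x‖))) = ENNReal.ofReal D * g τ x := by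
        rw [ENNReal.ofReal_mul hD0, hg]
        simp only
        rw [ENNReal.ofReal_add (by positivity) (by positivity), ENNReal.ofReal_pow (norm_nonneg _),
          ENNReal.ofReal_mul zero_le_two, ENNReal.ofReal_ofNat, ENNReal.ofReal_mul (abs_nonneg _),
          ofReal_norm, ← Real.norm_eq_abs, ofReal_norm]
      rw [← ofReal_norm, ← h2]
      exact ENNReal.ofReal_le_ofReal h1
    · rw [indicator_of_notMem hx, mul_zero]
      have : R τ x = 0 := by simp only [hR, hχ0 x hx, inner_zero_right, mul_zero]
      rw [this, enorm_zero]
  -- `‖∫∫‖ₑ ≤ ∫⁻∫⁻`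
  have h1 : ‖∫ τ in Ioo s σ, ∫ x, R τ x‖ₑ ≤ ∫⁻ τ in Ioo s σ, ∫⁻ x, ‖R τ x‖ₑ :=
    (enorm_integral_le_lintegral_enorm _).trans (lintegral_mono fun τ => enorm_integral_le_lintegral_enorm _)
  have h2 : ∫⁻ τ in Ioo s σ, ∫⁻ x, ‖R τ x‖ₑ ≤ ∫⁻ τ in Ioo s 0, ∫⁻ x, ‖R τ x‖ₑ :=
    lintegral_mono_set (Ioo_subset_Ioo le_rfl hσ)
  have h3 : ∫⁻ τ in Ioo s 0, ∫⁻ x, ‖R τ x‖ₑ ≤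
      ∫⁻ τ in Ioo s 0, ENNReal.ofReal D * ∫⁻ x in ball x₁ b, g τ x := by
    refine lintegral_mono fun τ => ?_
    calc ∫⁻ x, ‖R τ x‖ₑ ≤ ∫⁻ x, ENNReal.ofReal D * (ball x₁ b).indicator (g τ) x := lintegral_mono (hpt τ)
      _ = ENNReal.ofReal D * ∫⁻ x in ball x₁ b, g τ x := by
          rw [lintegral_const_mul' _ _ ENNReal.ofReal_ne_top, lintegral_indicator measurableSet_ball]
  -- Tonelli on `(s,0) × B`
  have hgm : AEMeasurable (fun z : ℝ × EuclideanSpace ℝ (Fin 3) => g z.1 z.2)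
      (volume.restrict (Ioo s 0 ×ˢ ball x₁ b)) := by
    have hu : AEMeasurable (fun z : ℝ × EuclideanSpace ℝ (Fin 3) => ‖u z.1 z.2‖ₑ)
        (volume.restrict (Ioo s 0 ×ˢ ball x₁ b)) := hum.enorm
    have hp : AEMeasurable (fun z : ℝ × EuclideanSpace ℝ (Fin 3) => ‖p z.1 z.2‖ₑ)
        (volume.restrict (Ioo s 0 ×ˢ ball x₁ b)) := hpm.enorm
    exact (hu.pow_const 3).add ((hp.mul hu).const_mul 2)
  have hμ : (volume : Measure (ℝ × EuclideanSpace ℝ (Fin 3))).restrict (Ioo s 0 ×ˢ ball x₁ b) =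
      ((volume : Measure ℝ).restrict (Ioo s 0)).prod
        ((volume : Measure (EuclideanSpace ℝ (Fin 3))).restrict (ball x₁ b)) := by
    rw [Measure.prod_restrict, ← Measure.volume_eq_prod]
  have hgm' : AEMeasurable (fun z : ℝ × EuclideanSpace ℝ (Fin 3) => g z.1 z.2)
      (((volume : Measure ℝ).restrict (Ioo s 0)).prod
        ((volume : Measure (EuclideanSpace ℝ (Fin 3))).restrict (ball x₁ b))) := by
    rw [← hμ]; exact hgm
  have h4 : ∫⁻ τ in Ioo s 0, ∫⁻ x in ball x₁ b, g τ x = ∫⁻ z in Ioo s 0 ×ˢ ball x₁ b, g z.1 z.2 := by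
    rw [hμ]
    exact (lintegral_prod (fun z : ℝ × EuclideanSpace ℝ (Fin 3) => g z.1 z.2) hgm').symm
  have h5 : ‖∫ τ in Ioo s σ, ∫ x, R τ x‖ₑ ≤ ENNReal.ofReal (D * M) := by
    refine (h1.trans (h2.trans h3)).trans ?_
    rw [lintegral_const_mul' _ _ ENNReal.ofReal_ne_top, h4, ENNReal.ofReal_mul hD0]
    exact mul_le_mul' le_rfl hflux
  rw [← Real.norm_eq_abs]
  rw [← ofReal_norm] at h5
  exact (ENNReal.ofReal_le_ofReal_iff (by positivity)).1 h5

/-- **Cutoff energy against the ball energy, upper direction**: for `0 ≤ χ ≤ 1` vanishing off a ball `B`,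
`∫ χ |v|² ≤ ε` as soon as `∫⁻_B ‖v‖ₑ² ≤ ε` (if `χ|v|²` is not integrable the Bochner integral is `0`). [folklore] -/
theorem integral_mul_sq_le_of_setLIntegral_le {v : EuclideanSpace ℝ (Fin 3) → EuclideanSpace ℝ (Fin 3)}
    {χ : EuclideanSpace ℝ (Fin 3) → ℝ} (hχ0 : ∀ x, 0 ≤ χ x) (hχ1 : ∀ x, χ x ≤ 1)
    {x₁ : EuclideanSpace ℝ (Fin 3)} {b : ℝ} (hχs : ∀ x, x ∉ ball x₁ b → χ x = 0) {ε : ℝ} (hε : 0 ≤ ε)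
    (h : ∫⁻ x in ball x₁ b, ‖v x‖ₑ ^ 2 ≤ ENNReal.ofReal ε) :
    ∫ x, χ x * ‖v x‖ ^ 2 ≤ ε := by
  by_cases hi : Integrable (fun x => χ x * ‖v x‖ ^ 2)
  · have hnn : 0 ≤ᵐ[volume] fun x => χ x * ‖v x‖ ^ 2 :=
      Eventually.of_forall fun x => mul_nonneg (hχ0 x) (sq_nonneg _)
    rw [integral_eq_lintegral_of_nonneg_ae hnn hi.1]
    refine ENNReal.toReal_le_of_le_ofReal hε (le_trans ?_ h)
    rw [← lintegral_indicator measurableSet_ball]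
    refine lintegral_mono fun x => ?_
    by_cases hx : x ∈ ball x₁ b
    · rw [indicator_of_mem hx, ← ofReal_norm, ← ENNReal.ofReal_pow (norm_nonneg _)]
      exact ENNReal.ofReal_le_ofReal (by nlinarith [hχ1 x, hχ0 x, sq_nonneg ‖v x‖])
    · rw [indicator_of_notMem hx, hχs x hx, zero_mul, ENNReal.ofReal_zero]
  · rw [integral_undef hi]
    exact hε

/-- **Cutoff energy against the ball energy, lower direction**: for `0 ≤ χ` with `χ = 1` on a ball `B` and `χ|v|²`
integrable, `∫⁻_B ‖v‖ₑ² ≤ ofReal (∫ χ |v|²)`. [folklore] -/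
theorem setLIntegral_ball_le_ofReal_integral {v : EuclideanSpace ℝ (Fin 3) → EuclideanSpace ℝ (Fin 3)}
    {χ : EuclideanSpace ℝ (Fin 3) → ℝ} (hχ0 : ∀ x, 0 ≤ χ x) {x₁ : EuclideanSpace ℝ (Fin 3)} {a : ℝ}
    (hχ1 : ∀ x ∈ ball x₁ a, χ x = 1) (hi : Integrable (fun x => χ x * ‖v x‖ ^ 2)) :
    ∫⁻ x in ball x₁ a, ‖v x‖ₑ ^ 2 ≤ ENNReal.ofReal (∫ x, χ x * ‖v x‖ ^ 2) := by
  have hnn : 0 ≤ᵐ[volume] fun x => χ x * ‖v x‖ ^ 2 :=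
    Eventually.of_forall fun x => mul_nonneg (hχ0 x) (sq_nonneg _)
  rw [ofReal_integral_eq_lintegral_ofReal hi hnn, ← lintegral_indicator measurableSet_ball]
  refine lintegral_mono fun x => ?_
  by_cases hx : x ∈ ball x₁ a
  · rw [indicator_of_mem hx, hχ1 x hx, one_mul, ← ofReal_norm, ENNReal.ofReal_pow (norm_nonneg _)]
  · rw [indicator_of_notMem hx]
    exact bot_le

end Summit.NavierStokesRegularity.NavierStokesRegularity.Theorems.PowerGaugeEulerLiouville.ExtinctTrace

end
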